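import Mathlib
import Summits.CriticalPhenomena.CardyFormulaZ2.Theorems.CardyMagicRigidityNestingRigidityUVFarBiteOneScale
import Summits.CriticalPhenomena.CardyFormulaZ2.Theorems.CardyMagicRigidityNestingRigidityUVFarBiteCells
import Summits.CriticalPhenomena.CardyFormulaZ2.Theorems.CardyMagicRigidityNestingRigidityUVFarBiteMicro
import HarnessLib

/-!
# Crux `NestingRigidity`, line `positive-cone-weight-doubling`: the PIECES of the multi-scale brick
# (dyadic scales, cell splits, the K6 scales and the microscopic scale, exponent arithmetic)

Crux `Summit.CriticalPhenomena.CardyFormulaZ2.Theses.CardyMagicRigidity.NestingRigidity`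
(stmt-CriticalPhenomena-4835), line `positive-cone-weight-doubling`, registered helper Ξ
`uvFarBite_expMoment_latticeEnsembles`.  The generic brick behind Ξ (…UVFarBiteMultiScale: all-order
CENTRED exponential moments of `S = Σ_{u ∈ X_δ, trace u ⊆ D} g u` for `D ⊆ B(x₀, ρ)`,
`|g u| ≤ κ diam(u)²`) is assembled from the pieces proved here (no cited fact, no definition; the
cell data are the file-local notations of …UVFarBiteCells, re-declared verbatim):

* §1 dyadic sides `h_k = H 2^{-k}`: every diameter in `[H 2^{-n}, H)` has exactly one scale `k < n`
  (registered anchor `exists_dyadic_scale`), and the scale split of a finite loop family;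
* §2 the cell split of a finite loop family at side `h`, and the cell families in the inner-loop
  form of …UVFarBiteOneScale (`trace ⊆ D ∩ doubled cell`); integrability of inner-loop statistics;
* §3 the two kinds of pieces on `E ∈ latticeEnsembles`: a K6 SCALE (`UVFarBite.scalePiece`: the
  one-scale anchor `expMoment_centredSum_sepRegions_le_latticeEnsembles` fed with chessboard
  separation and the K6 hypothesis at all centres, `b = κ h²`) and the MICROSCOPIC scale
  (`UVFarBite.microPiece`: side `4 c₀ δ`, window counts bounded deterministically by the hypothesis
  of `exists_ncard_loops_subset_ball_le`, trivial exponential moments);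
* §4 the exponent arithmetic: at scale `k` the order constraint is `1152 |a| κ ρ² 2^{-k} ≤ A` and the
  exponent is `≤ 331776 a² κ² ρ⁴ K² 2^{-k}` (summable); the microscopic exponent is
  `≤ 576 (|a| κ ρ²)² c₀² (2 + 8c₀)² Kμ²`.
-/

noncomputable section

open MeasureTheory ProbabilityTheory Set Filter Metric
open scoped Real Topology BigOperators

namespace Summit.CriticalPhenomena.CardyFormulaZ2.Cruxes.NestingRigidity.PositiveConeWeightDoubling

open Literature.Probability.RandomPlanarGeometry Literature.Probability.Percolation
  Literature.Probability.LatticeModels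
open Summit.CriticalPhenomena.CardyFormulaZ2.Cruxes.NestingRigidity.RingCloudTomography

/-- Abscissa of the left edge of the bounding box of a loop (local notation, as in …UVFarBiteCells). -/
local notation3 "XI[" u "]" => sInf (Complex.re '' UnbasedLoop.range u)
/-- Ordinate of the bottom edge of the bounding box of a loop (local notation). -/
local notation3 "YI[" u "]" => sInf (Complex.im '' UnbasedLoop.range u)
/-- The grid cell (side `h`) containing the lower-left corner of the bounding box (local notation). -/
local notation3 "IDX[" h ", " u "]" => ((⌊XI[u] / h⌋, ⌊YI[u] / h⌋) : ℤ × ℤ)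
/-- The doubled cell `[ih, (i+2)h] × [jh, (j+2)h]` of the grid cell `c = (i, j)` (local notation). -/
local notation3 "BOX[" h ", " c "]" => {z : ℂ | ((Prod.fst c : ℤ) : ℝ) * h ≤ z.re ∧
  z.re ≤ (((Prod.fst c : ℤ) : ℝ) + 2) * h ∧ ((Prod.snd c : ℤ) : ℝ) * h ≤ z.im ∧
  z.im ≤ (((Prod.snd c : ℤ) : ℝ) + 2) * h}
/-- The centre `((i+1)h, (j+1)h)` of the doubled cell (local notation). -/
local notation3 "CTR[" h ", " c "]" =>
  (Complex.mk ((((Prod.fst c : ℤ) : ℝ) + 1) * h) ((((Prod.snd c : ℤ) : ℝ) + 1) * h) : ℂ)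
/-- The cells that loops inside `B(x₀, ρ)` can be assigned to (local notation). -/
local notation3 "RNG[" h ", " x₀ ", " ρ "]" => (Finset.Icc ⌊(Complex.re x₀ - ρ) / h⌋ ⌊(Complex.re x₀ + ρ) / h⌋ ×ˢ
  Finset.Icc ⌊(Complex.im x₀ - ρ) / h⌋ ⌊(Complex.im x₀ + ρ) / h⌋ : Finset (ℤ × ℤ))

namespace UVFarBite

/-! ## §1 Dyadic sides and the scale of a loop -/

/-- The sides decrease. -/
theorem side_le_side {H : ℝ} (hH : 0 ≤ H) {k k' : ℕ} (h : k ≤ k') : H / 2 ^ k' ≤ H / 2 ^ k :=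
  div_le_div_of_nonneg_left hH (pow_pos two_pos _) (pow_le_pow_right₀ one_le_two h)

end UVFarBite

/-- **The dyadic scale of a diameter** (helper toward Ξ `uvFarBite_expMoment_latticeEnsembles`, line
`positive-cone-weight-doubling`; registered anchor of this file): every `d ∈ [H 2^{-n}, H)` lies in
exactly one of the `n` dyadic bands `[H 2^{-k-1}, H 2^{-k})`, `k < n` — the scale split behind the
multi-scale bound. -/
theorem exists_dyadic_scale : ∀ (H d : ℝ) (n : ℕ), H / 2 ^ n ≤ d → d < H →
    ∃ k < n, H / 2 ^ k / 2 ≤ d ∧ d < H / 2 ^ k := by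
  intro H d n hlo hhi
  classical
  cases n with
  | zero => rw [pow_zero, div_one] at hlo; linarith
  | succ m =>
    have hm : H / 2 ^ m / 2 ≤ d := by rwa [pow_succ, ← div_div] at hlo
    have hex : ∃ k, H / 2 ^ k / 2 ≤ d := ⟨m, hm⟩
    refine ⟨Nat.find hex, lt_of_le_of_lt (Nat.find_min' hex hm) m.lt_succ_self, Nat.find_spec hex, ?_⟩
    rcases Nat.eq_zero_or_pos (Nat.find hex) with h0 | hpos
    · rw [h0, pow_zero, div_one]; exact hhi
    · obtain ⟨j, hj⟩ := Nat.exists_eq_succ_of_ne_zero hpos.ne'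
      have hmin := Nat.find_min hex (show j < Nat.find hex by omega)
      rw [hj, pow_succ, ← div_div]
      exact not_le.1 hmin

namespace UVFarBite

/-- **Scale split of a finite loop family** with diameters `< H`: the microscopic loops
(`diam < H/2^n`) plus the `n` dyadic scales `[H/2^{k+1}, H/2^k)`, `k < n`. -/
theorem finsum_mem_eq_micro_add_sum_scales {B : Set (UnbasedLoop ℂ)} (hB : B.Finite) {H : ℝ}
    (hH : 0 < H) (n : ℕ) (hBH : ∀ u ∈ B, diam u.range < H) (g : UnbasedLoop ℂ → ℝ) :
    ∑ᶠ u ∈ B, g u = (∑ᶠ u ∈ {u ∈ B | diam u.range < H / 2 ^ n}, g u) +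
      ∑ k ∈ Finset.range n,
        ∑ᶠ u ∈ {u ∈ B | H / 2 ^ k / 2 ≤ diam u.range ∧ diam u.range < H / 2 ^ k}, g u := by
  set Bμ := {u ∈ B | diam u.range < H / 2 ^ n} with hBμ
  set Bk : ℕ → Set (UnbasedLoop ℂ) := fun k ↦
    {u ∈ B | H / 2 ^ k / 2 ≤ diam u.range ∧ diam u.range < H / 2 ^ k} with hBk
  have hcover : B = Bμ ∪ ⋃ k ∈ (↑(Finset.range n) : Set ℕ), Bk k := by
    ext u
    simp only [mem_union, mem_iUnion, Finset.coe_range, mem_Iio, exists_prop, hBμ, hBk, mem_setOf_eq]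
    constructor
    · intro hu
      by_cases hμ : diam u.range < H / 2 ^ n
      · exact Or.inl ⟨hu, hμ⟩
      · obtain ⟨k, hk, hsc⟩ := exists_dyadic_scale H _ n (not_lt.1 hμ) (hBH u hu)
        exact Or.inr ⟨k, hk, hu, hsc⟩
    · rintro (⟨hu, -⟩ | ⟨k, -, hu, -⟩) <;> exact hu
  have hdisjμ : Disjoint Bμ (⋃ k ∈ (↑(Finset.range n) : Set ℕ), Bk k) := by
    rw [Set.disjoint_left]
    rintro u ⟨-, hμ⟩ hU
    simp only [mem_iUnion, Finset.coe_range, mem_Iio, exists_prop, hBk, mem_setOf_eq] at hU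
    obtain ⟨k, hk, -, hlo, -⟩ := hU
    have h1 := side_le_side hH.le (Nat.succ_le_of_lt hk)
    rw [pow_succ, ← div_div] at h1
    exact absurd (hlo.trans_lt (hμ.trans_le h1)) (lt_irrefl _)
  have hpd : (↑(Finset.range n) : Set ℕ).PairwiseDisjoint Bk := by
    intro k _ k' _ hkk'
    change Disjoint (Bk k) (Bk k')
    rw [Set.disjoint_left]
    rintro u ⟨-, hlo, hhi⟩ ⟨-, hlo', hhi'⟩
    rcases lt_or_gt_of_ne hkk' with h | h
    · have h1 := side_le_side hH.le (Nat.succ_le_of_lt h); rw [pow_succ, ← div_div] at h1; linarith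
    · have h1 := side_le_side hH.le (Nat.succ_le_of_lt h); rw [pow_succ, ← div_div] at h1; linarith
  have hUsub : (⋃ k ∈ (↑(Finset.range n) : Set ℕ), Bk k) ⊆ B :=
    iUnion₂_subset fun k _ u hu ↦ hu.1
  calc ∑ᶠ u ∈ B, g u = ∑ᶠ u ∈ Bμ ∪ ⋃ k ∈ (↑(Finset.range n) : Set ℕ), Bk k, g u :=
        finsum_mem_congr hcover fun _ _ ↦ rfl
    _ = (∑ᶠ u ∈ Bμ, g u) + ∑ᶠ u ∈ ⋃ k ∈ (↑(Finset.range n) : Set ℕ), Bk k, g u :=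
        finsum_mem_union hdisjμ (hB.subset fun u hu ↦ hu.1) (hB.subset hUsub)
    _ = (∑ᶠ u ∈ Bμ, g u) + ∑ᶠ k ∈ (↑(Finset.range n) : Set ℕ), ∑ᶠ u ∈ Bk k, g u := by
        rw [finsum_mem_biUnion hpd (Finset.finite_toSet _) fun k _ ↦ hB.subset fun u hu ↦ hu.1]
    _ = _ := by rw [finsum_mem_coe_finset]

/-! ## §2 Cells: the cell split and the cell families in inner-loop form -/

/-- **Cell split of a finite loop family** inside `B(x₀, ρ)` at side `h`: the sum over the family is
the sum over the cell range of the sums over the loops indexed by each cell. -/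
theorem finsum_mem_eq_sum_cells {B : Set (UnbasedLoop ℂ)} (hB : B.Finite) {h : ℝ} (hh : 0 < h)
    {x₀ : ℂ} {ρ : ℝ} (hsub : ∀ u ∈ B, u.range ⊆ ball x₀ ρ) (g : UnbasedLoop ℂ → ℝ) :
    ∑ᶠ u ∈ B, g u = ∑ c ∈ RNG[h, x₀, ρ], ∑ᶠ u ∈ {u ∈ B | IDX[h, u] = c}, g u := by
  have hcover : B = ⋃ c ∈ (↑(RNG[h, x₀, ρ]) : Set (ℤ × ℤ)), {u ∈ B | IDX[h, u] = c} := by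
    ext u
    simp only [mem_iUnion, Finset.mem_coe, exists_prop, mem_setOf_eq]
    exact ⟨fun hu ↦ ⟨_, cellIdx_mem_cellRange hh (hsub u hu), hu, rfl⟩, fun ⟨_, _, hu, _⟩ ↦ hu⟩
  have hpd : (↑(RNG[h, x₀, ρ]) : Set (ℤ × ℤ)).PairwiseDisjoint fun c ↦ {u ∈ B | IDX[h, u] = c} := by
    intro c _ c' _ hne
    change Disjoint {u ∈ B | IDX[h, u] = c} {u ∈ B | IDX[h, u] = c'}
    exact Set.disjoint_left.2 fun u hu hu' ↦ hne (hu.2.symm.trans hu'.2)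
  calc ∑ᶠ u ∈ B, g u
      = ∑ᶠ u ∈ ⋃ c ∈ (↑(RNG[h, x₀, ρ]) : Set (ℤ × ℤ)), {u ∈ B | IDX[h, u] = c}, g u :=
        finsum_mem_congr hcover fun _ _ ↦ rfl
    _ = ∑ᶠ c ∈ (↑(RNG[h, x₀, ρ]) : Set (ℤ × ℤ)), ∑ᶠ u ∈ {u ∈ B | IDX[h, u] = c}, g u :=
        finsum_mem_biUnion hpd (Finset.finite_toSet _) fun c _ ↦ hB.subset fun u hu ↦ hu.1
    _ = _ := by rw [finsum_mem_coe_finset]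

/-- **The loops of a cell in inner-loop form**: for a predicate forcing `diam ≤ h`, the loops inside
`D` with `Q'` indexed by the cell `c` are the loops inside `D ∩ (doubled cell c)` with `Q'` indexed
by `c` (`range_subset_cellBox`). -/
theorem sep_sep_idx_eq (L : Set (UnbasedLoop ℂ)) (D : Set ℂ) {h : ℝ} (hh : 0 < h)
    (Q' : UnbasedLoop ℂ → Prop) (hQ' : ∀ u, Q' u → diam u.range ≤ h) (c : ℤ × ℤ) :
    {u ∈ {u ∈ {u ∈ L | u.range ⊆ D} | Q' u} | IDX[h, u] = c} =
      {u ∈ L | u.range ⊆ D ∩ BOX[h, c] ∧ (Q' u ∧ IDX[h, u] = c)} := by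
  ext u
  simp only [mem_setOf_eq, subset_inter_iff]
  constructor
  · rintro ⟨⟨⟨hu, hD⟩, hQ⟩, hc⟩
    refine ⟨hu, ⟨hD, ?_⟩, hQ, hc⟩
    rw [← hc]
    exact range_subset_cellBox hh (hQ' u hQ)
  · rintro ⟨hu, ⟨hD, -⟩, hQ, hc⟩
    exact ⟨⟨⟨hu, hD⟩, hQ⟩, hc⟩

/-- **Inner-loop statistics with bounded weights are integrable** at every fixed mesh (both
lattices): `|Σ_{trace ⊆ A, Q} g| ≤ b · #{trace ⊆ B(x, R)} ≤ b · N(δ)`. -/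
theorem integrable_finsum_inner : ∀ E ∈ latticeEnsembles, ∀ {δ : ℝ}, 0 < δ → ∀ (A : Set ℂ) (x : ℂ)
    (R : ℝ) (Q : UnbasedLoop ℂ → Prop) (g : UnbasedLoop ℂ → ℝ) {b : ℝ}, 0 ≤ b → A ⊆ ball x R →
    (∀ u, u.range ⊆ A → Q u → |g u| ≤ b) →
    Integrable (fun ω ↦ ∑ᶠ u ∈ {u ∈ (E.X δ ω).loops | u.range ⊆ A ∧ Q u}, g u) E.P := by
  intro E hE δ hδ A x R Q g b hb hA hg
  haveI := isProbabilityMeasure_of_mem hE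
  obtain ⟨N, hN⟩ := BigLoopsBall.exists_ncard_loops_sep_le_ball E hE hδ x R
  refine Integrable.of_bound (FirstMoment.measurable_finsum_loops_sep E hE δ _ g).aestronglyMeasurable
    (b * N) (Eventually.of_forall fun ω ↦ ?_)
  rw [Real.norm_eq_abs]
  refine (abs_finsum_inner_le_mul_ncard E hE hδ ω A x R Q (fun _ ↦ True) g hb hA
    fun u hu hq ↦ ⟨hg u hu hq, trivial⟩).trans ?_
  gcongr
  exact_mod_cast (hN (fun u ↦ u.range ⊆ ball x R ∧ True) (fun u h ↦ h.1) ω).2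

/-! ## §3 The two kinds of pieces: a K6 scale and the microscopic scale -/

/-- **A K6 scale.**  Side `h` with `c₀ δ ≤ h/2` and `2δ < h`; cell statistics = loops inside
`D ∩ (doubled cell)` of diameter in `[h/2, h)` indexed by the cell, weight `|g| ≤ κ diam² ≤ κ h²`;
window counts = loops in `B(centre, 3h)` of diameter `≥ h/2`, bounded in exponential moment by the
K6 hypothesis; the one-scale anchor gives
`E exp((a/w) Σ_c (Y_c − E Y_c)) ≤ exp(2 · #cells · 9 · (a/w)² (κh²)² K²)` once `9 |a/w| κ h² ≤ A`. -/
theorem scalePiece : ∀ E ∈ latticeEnsembles, ∀ (A K c₀ : ℝ),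
    (∀ (x : ℂ) (l δ : ℝ), 0 < l → 0 < δ → c₀ * δ ≤ l * 1 →
      Integrable (fun ω ↦ Real.exp ((A + 1) * ({u ∈ (E.X δ ω).loops |
        u.range ⊆ Metric.ball x (l * 6) ∧ l * 1 ≤ Metric.diam u.range}.ncard : ℝ))) E.P ∧
      ∫ ω, Real.exp ((A + 1) * ({u ∈ (E.X δ ω).loops |
        u.range ⊆ Metric.ball x (l * 6) ∧ l * 1 ≤ Metric.diam u.range}.ncard : ℝ)) ∂E.P ≤ K) →
    ∀ (x₀ : ℂ) (ρ κ a δ h w : ℝ) (D : Set ℂ) (g : UnbasedLoop ℂ → ℝ), 0 ≤ κ → 0 < δ →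
      (∀ u : UnbasedLoop ℂ, u.range ⊆ D → |g u| ≤ κ * diam u.range ^ 2) → 0 < w →
      c₀ * δ ≤ h / 2 → 2 * δ < h → 9 * (|a / w| * (κ * h ^ 2)) ≤ A →
      Integrable (fun ω ↦ Real.exp (a / w * ∑ c ∈ RNG[h, x₀, ρ],
        ((∑ᶠ u ∈ {u ∈ (E.X δ ω).loops | u.range ⊆ D ∩ BOX[h, c] ∧
            ((h / 2 ≤ diam u.range ∧ diam u.range < h) ∧ IDX[h, u] = c)}, g u) -
          ∫ ω', (∑ᶠ u ∈ {u ∈ (E.X δ ω').loops | u.range ⊆ D ∩ BOX[h, c] ∧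
            ((h / 2 ≤ diam u.range ∧ diam u.range < h) ∧ IDX[h, u] = c)}, g u) ∂E.P))) E.P ∧
      ∫ ω, Real.exp (a / w * ∑ c ∈ RNG[h, x₀, ρ],
        ((∑ᶠ u ∈ {u ∈ (E.X δ ω).loops | u.range ⊆ D ∩ BOX[h, c] ∧
            ((h / 2 ≤ diam u.range ∧ diam u.range < h) ∧ IDX[h, u] = c)}, g u) -
          ∫ ω', (∑ᶠ u ∈ {u ∈ (E.X δ ω').loops | u.range ⊆ D ∩ BOX[h, c] ∧
            ((h / 2 ≤ diam u.range ∧ diam u.range < h) ∧ IDX[h, u] = c)}, g u) ∂E.P)) ∂E.P ≤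
        Real.exp (2 * (RNG[h, x₀, ρ]).card * (9 : ℕ) * (a / w) ^ 2 * (κ * h ^ 2) ^ 2 * K ^ 2) := by
  intro E hE A K c₀ hK6 x₀ ρ κ a δ h w D g hκ hδ hg hw hch h2δ hl
  have hh : 0 < h := by linarith
  have hwin : ∀ c : ℤ × ℤ, D ∩ BOX[h, c] ⊆ ball CTR[h, c] (h / 2 * 6) := fun c ↦
    Set.inter_subset_right.trans (by
      rw [show h / 2 * 6 = 3 * h by ring]
      exact cellBox_subset_ball hh c)
  refine expMoment_centredSum_sepRegions_le_latticeEnsembles E hE δ hδ (ℤ × ℤ) 9 (RNG[h, x₀, ρ])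
    (fun c ↦ (⟨(3 * (c.1 % 3) + c.2 % 3).toNat, by omega⟩ : Fin 9)) (fun c ↦ D ∩ BOX[h, c])
    (fun c ↦ CTR[h, c]) (h / 2 * 6)
    (fun c u ↦ (h / 2 ≤ diam u.range ∧ diam u.range < h) ∧ IDX[h, u] = c)
    (fun u ↦ h / 2 * 1 ≤ diam u.range) g (κ * h ^ 2) A K (a / w) (by norm_num) (by positivity)
    (fun c c' hne hcl p hp q hq ↦ ?_) (fun c _ ↦ hwin c) (fun c _ u hu hq ↦ ⟨?_, ?_⟩)
    (fun c _ ↦ hK6 _ _ _ (by positivity) hδ (by rwa [mul_one])) hl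
  · -- separation of same-class doubled cells
    have hcl' := congrArg Fin.val hcl
    exact two_mul_lt_dist_of_cls_eq hδ.le h2δ hne hcl' hp.2 hq.2
  · -- the weight bound on the cell family
    refine (hg u (hu.trans Set.inter_subset_left)).trans ?_
    have hd0 : 0 ≤ diam u.range := diam_nonneg
    have hd : diam u.range ≤ h := hq.1.2.le
    exact mul_le_mul_of_nonneg_left (pow_le_pow_left₀ hd0 hd 2) hκ
  · rw [mul_one]; exact hq.1.1

/-- **The microscopic scale.**  Side `s = 4 c₀ δ` (`c₀ ≥ 1`); cell statistics = loops inside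
`D ∩ (doubled cell)` of diameter `< hₙ ≤ s` indexed by the cell, `|g| ≤ κ s²`; the window counts are
ALL loops in `B(centre, 12 c₀ δ)`, at most `M` by the deterministic microscopic count, so
`E e^{(A'+1)N} ≤ e^{(A'+1)M}` trivially with `A' = 9 |l| κ s²`. -/
theorem microPiece : ∀ E ∈ latticeEnsembles, ∀ (c₀ : ℝ) (M : ℕ), 1 ≤ c₀ →
    (∀ (δ : ℝ), 0 < δ → ∀ (x : ℂ) (ω : E.Ω),
      {u ∈ (E.X δ ω).loops | u.range ⊆ Metric.ball x (12 * c₀ * δ)}.Finite ∧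
        {u ∈ (E.X δ ω).loops | u.range ⊆ Metric.ball x (12 * c₀ * δ)}.ncard ≤ M) →
    ∀ (x₀ : ℂ) (ρ κ l δ hn : ℝ) (D : Set ℂ) (g : UnbasedLoop ℂ → ℝ), 0 ≤ κ → 0 < δ →
      (∀ u : UnbasedLoop ℂ, u.range ⊆ D → |g u| ≤ κ * diam u.range ^ 2) → hn ≤ 4 * c₀ * δ →
      Integrable (fun ω ↦ Real.exp (l * ∑ c ∈ RNG[4 * c₀ * δ, x₀, ρ],
        ((∑ᶠ u ∈ {u ∈ (E.X δ ω).loops | u.range ⊆ D ∩ BOX[4 * c₀ * δ, c] ∧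
            (diam u.range < hn ∧ IDX[4 * c₀ * δ, u] = c)}, g u) -
          ∫ ω', (∑ᶠ u ∈ {u ∈ (E.X δ ω').loops | u.range ⊆ D ∩ BOX[4 * c₀ * δ, c] ∧
            (diam u.range < hn ∧ IDX[4 * c₀ * δ, u] = c)}, g u) ∂E.P))) E.P ∧
      ∫ ω, Real.exp (l * ∑ c ∈ RNG[4 * c₀ * δ, x₀, ρ],
        ((∑ᶠ u ∈ {u ∈ (E.X δ ω).loops | u.range ⊆ D ∩ BOX[4 * c₀ * δ, c] ∧
            (diam u.range < hn ∧ IDX[4 * c₀ * δ, u] = c)}, g u) -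
          ∫ ω', (∑ᶠ u ∈ {u ∈ (E.X δ ω').loops | u.range ⊆ D ∩ BOX[4 * c₀ * δ, c] ∧
            (diam u.range < hn ∧ IDX[4 * c₀ * δ, u] = c)}, g u) ∂E.P)) ∂E.P ≤
        Real.exp (2 * (RNG[4 * c₀ * δ, x₀, ρ]).card * (9 : ℕ) * l ^ 2 * (κ * (4 * c₀ * δ) ^ 2) ^ 2 *
          Real.exp ((9 * (|l| * (κ * (4 * c₀ * δ) ^ 2)) + 1) * M) ^ 2) := by
  intro E hE c₀ M hc₀ hM x₀ ρ κ l δ hn D g hκ hδ hg hhn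
  haveI := isProbabilityMeasure_of_mem hE
  set sμ : ℝ := 4 * c₀ * δ with hsμ
  have hs0 : 0 < sμ := by positivity
  have h2δ : 2 * δ < sμ := by rw [hsμ]; nlinarith
  have hwin : ∀ c : ℤ × ℤ, D ∩ BOX[sμ, c] ⊆ ball CTR[sμ, c] (12 * c₀ * δ) := fun c ↦
    Set.inter_subset_right.trans (by
      rw [show 12 * c₀ * δ = 3 * sμ by rw [hsμ]; ring]
      exact cellBox_subset_ball hs0 c)
  set A' : ℝ := 9 * (|l| * (κ * sμ ^ 2)) with hA'
  have hA'0 : 0 ≤ A' := by positivity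
  -- the trivial exponential moment of the microscopic window counts
  have hK : ∀ c ∈ RNG[sμ, x₀, ρ],
      Integrable (fun ω ↦ Real.exp ((A' + 1) * ({u ∈ (E.X δ ω).loops |
        u.range ⊆ ball CTR[sμ, c] (12 * c₀ * δ) ∧ True}.ncard : ℝ))) E.P ∧
      ∫ ω, Real.exp ((A' + 1) * ({u ∈ (E.X δ ω).loops |
        u.range ⊆ ball CTR[sμ, c] (12 * c₀ * δ) ∧ True}.ncard : ℝ)) ∂E.P ≤
          Real.exp ((A' + 1) * M) := by
    intro c _
    have hint := BigLoopsBall.integrable_exp_mul_ncard_loops_sep E hE hδ CTR[sμ, c] (12 * c₀ * δ)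
      (A' + 1) (fun u ↦ u.range ⊆ ball CTR[sμ, c] (12 * c₀ * δ) ∧ True) fun u h ↦ h.1
    refine ⟨hint, ?_⟩
    have hle : ∀ ω, Real.exp ((A' + 1) * ({u ∈ (E.X δ ω).loops |
        u.range ⊆ ball CTR[sμ, c] (12 * c₀ * δ) ∧ True}.ncard : ℝ)) ≤ Real.exp ((A' + 1) * M) := by
      intro ω
      refine Real.exp_le_exp.2 (mul_le_mul_of_nonneg_left ?_ (by linarith))
      obtain ⟨hfin, hcard⟩ := hM δ hδ CTR[sμ, c] ω
      have hsub : {u ∈ (E.X δ ω).loops | u.range ⊆ ball CTR[sμ, c] (12 * c₀ * δ) ∧ True} ⊆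
          {u ∈ (E.X δ ω).loops | u.range ⊆ ball CTR[sμ, c] (12 * c₀ * δ)} := fun u hu ↦ ⟨hu.1, hu.2.1⟩
      exact_mod_cast (Set.ncard_le_ncard hsub hfin).trans hcard
    calc ∫ ω, Real.exp ((A' + 1) * ({u ∈ (E.X δ ω).loops |
          u.range ⊆ ball CTR[sμ, c] (12 * c₀ * δ) ∧ True}.ncard : ℝ)) ∂E.P
        ≤ ∫ _ω, Real.exp ((A' + 1) * M) ∂E.P := integral_mono hint (integrable_const _) hle
      _ = Real.exp ((A' + 1) * M) := by rw [integral_const, probReal_univ, one_smul]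
  exact expMoment_centredSum_sepRegions_le_latticeEnsembles E hE δ hδ (ℤ × ℤ) 9 (RNG[sμ, x₀, ρ])
    (fun c ↦ (⟨(3 * (c.1 % 3) + c.2 % 3).toNat, by omega⟩ : Fin 9)) (fun c ↦ D ∩ BOX[sμ, c])
    (fun c ↦ CTR[sμ, c]) (12 * c₀ * δ) (fun c u ↦ diam u.range < hn ∧ IDX[sμ, u] = c)
    (fun _ ↦ True) g (κ * sμ ^ 2) A' (Real.exp ((A' + 1) * M)) l (by norm_num) (by positivity)
    (fun c c' hne hcl p hp q hq ↦
      two_mul_lt_dist_of_cls_eq hδ.le h2δ hne (congrArg Fin.val hcl) hp.2 hq.2)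
    (fun c _ ↦ hwin c)
    (fun c _ u hu hq ↦ ⟨(hg u (hu.trans Set.inter_subset_left)).trans
      (mul_le_mul_of_nonneg_left (pow_le_pow_left₀ diam_nonneg (hq.1.le.trans hhn) 2) hκ), trivial⟩)
    hK le_rfl

/-! ## §4 Arithmetic of the exponents -/

/-- The weights: `1/(8·2^k) = (1/8)(1/2)^k`. -/
theorem weight_eq (k : ℕ) : (1 : ℝ) / (8 * 2 ^ k) = 1 / 8 * (1 / 2) ^ k := by
  rw [one_div_pow]; field_simp

/-- **The order constraint at scale `k`**: `9 |a/w_k| κ h_k² = 1152 |a| κ ρ² / 2^k ≤ 1152 |a| κ ρ²`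
(`w_k = 1/(8·2^k)`, `h_k = 4ρ/2^k`). -/
theorem order_scale_le (a κ ρ : ℝ) (hκ : 0 ≤ κ) (k : ℕ) :
    9 * (|a / (1 / (8 * 2 ^ k))| * (κ * (4 * ρ / 2 ^ k) ^ 2)) ≤ 1152 * |a| * κ * ρ ^ 2 := by
  set t : ℝ := 2 ^ k with ht
  have ht0 : 0 < t := by positivity
  have ht1 : 1 ≤ t := one_le_pow₀ (by norm_num)
  rw [abs_div, abs_of_pos (by positivity : (0 : ℝ) < 1 / (8 * t))]
  have e : 9 * (|a| / (1 / (8 * t)) * (κ * (4 * ρ / t) ^ 2)) = 1152 * |a| * κ * ρ ^ 2 / t := by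
    field_simp; ring
  rw [e]
  exact div_le_self (by positivity) ht1

/-- **The exponent at scale `k`**: with `#cells ≤ (2ρ/h_k + 2)² ≤ 9·4^k`,
`w_k · 2 · #cells · 9 · (a/w_k)² (κ h_k²)² K² ≤ 331776 a² κ² ρ⁴ K² (1/2)^k`. -/
theorem exponent_scale_le {a κ ρ K S : ℝ} (hρ : 0 < ρ) (k : ℕ)
    (hS : S ≤ (2 * ρ / (4 * ρ / 2 ^ k) + 2) ^ 2) :
    1 / (8 * 2 ^ k) * (2 * S * (9 : ℕ) * (a / (1 / (8 * 2 ^ k))) ^ 2 * (κ * (4 * ρ / 2 ^ k) ^ 2) ^ 2 * K ^ 2) ≤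
      331776 * a ^ 2 * κ ^ 2 * ρ ^ 4 * K ^ 2 * (1 / 2) ^ k := by
  set t : ℝ := 2 ^ k with ht
  have ht0 : 0 < t := by positivity
  have ht1 : 1 ≤ t := one_le_pow₀ (by norm_num)
  have hS' : S ≤ 9 * t ^ 2 := by
    refine hS.trans ?_
    rw [show 2 * ρ / (4 * ρ / t) + 2 = t / 2 + 2 by field_simp; ring]
    nlinarith
  have e : 1 / (8 * t) * (2 * S * (9 : ℕ) * (a / (1 / (8 * t))) ^ 2 * (κ * (4 * ρ / t) ^ 2) ^ 2 * K ^ 2) =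
      S * (36864 * a ^ 2 * κ ^ 2 * ρ ^ 4 * K ^ 2 / t ^ 3) := by
    push_cast; field_simp; ring
  rw [e, one_div_pow, ← ht]
  calc S * (36864 * a ^ 2 * κ ^ 2 * ρ ^ 4 * K ^ 2 / t ^ 3)
      ≤ 9 * t ^ 2 * (36864 * a ^ 2 * κ ^ 2 * ρ ^ 4 * K ^ 2 / t ^ 3) :=
        mul_le_mul_of_nonneg_right hS' (by positivity)
    _ = 331776 * a ^ 2 * κ ^ 2 * ρ ^ 4 * K ^ 2 * (1 / t) := by field_simp; ring

/-- **The microscopic exponent**: with `s = 4c₀δ ≤ 4c₀ρ`, `#cells ≤ (2ρ/s + 2)²`, `K' ≤ Kμ`,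
`(1/2) · 2 · #cells · 9 · (2a)² (κ s²)² K'² ≤ 576 (|a| κ ρ²)² c₀² (2 + 8c₀)² Kμ²`. -/
theorem exponent_micro_le {a κ ρ s S K' Kμ c₀ : ℝ} (hρ : 0 < ρ) (hs : 0 < s) (hc₀ : 0 ≤ c₀)
    (hsρ : s ≤ 4 * c₀ * ρ) (hS : S ≤ (2 * ρ / s + 2) ^ 2) (hK'0 : 0 ≤ K') (hK' : K' ≤ Kμ) :
    1 / 2 * (2 * S * (9 : ℕ) * (a / (1 / 2)) ^ 2 * (κ * s ^ 2) ^ 2 * K' ^ 2) ≤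
      576 * (|a| * κ * ρ ^ 2) ^ 2 * (c₀ ^ 2 * (2 + 8 * c₀) ^ 2) * Kμ ^ 2 := by
  have e1 : 1 / 2 * (2 * S * (9 : ℕ) * (a / (1 / 2)) ^ 2 * (κ * s ^ 2) ^ 2 * K' ^ 2) =
      36 * S * a ^ 2 * κ ^ 2 * s ^ 4 * K' ^ 2 := by push_cast; ring
  rw [e1]
  have h1 : 36 * S * a ^ 2 * κ ^ 2 * s ^ 4 * K' ^ 2 ≤ 36 * (2 * ρ / s + 2) ^ 2 * a ^ 2 * κ ^ 2 * s ^ 4 * Kμ ^ 2 := by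
    gcongr
  refine h1.trans ?_
  have e2 : 36 * (2 * ρ / s + 2) ^ 2 * a ^ 2 * κ ^ 2 * s ^ 4 * Kμ ^ 2 =
      36 * a ^ 2 * κ ^ 2 * ((2 * ρ + 2 * s) * s) ^ 2 * Kμ ^ 2 := by
    field_simp
  rw [e2]
  have h2 : (2 * ρ + 2 * s) * s ≤ (2 * ρ + 8 * c₀ * ρ) * (4 * c₀ * ρ) := by
    have : 2 * s ≤ 8 * c₀ * ρ := by linarith
    exact mul_le_mul (by linarith) hsρ hs.le (by positivity)
  have h3 : ((2 * ρ + 2 * s) * s) ^ 2 ≤ ((2 * ρ + 8 * c₀ * ρ) * (4 * c₀ * ρ)) ^ 2 :=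
    pow_le_pow_left₀ (by positivity) h2 2
  calc 36 * a ^ 2 * κ ^ 2 * ((2 * ρ + 2 * s) * s) ^ 2 * Kμ ^ 2
      ≤ 36 * a ^ 2 * κ ^ 2 * ((2 * ρ + 8 * c₀ * ρ) * (4 * c₀ * ρ)) ^ 2 * Kμ ^ 2 := by gcongr
    _ = 576 * (|a| * κ * ρ ^ 2) ^ 2 * (c₀ ^ 2 * (2 + 8 * c₀) ^ 2) * Kμ ^ 2 := by
        rw [show (|a| * κ * ρ ^ 2) ^ 2 = a ^ 2 * κ ^ 2 * ρ ^ 4 by rw [mul_pow, mul_pow, sq_abs]; ring]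
        ring

end UVFarBite

end Summit.CriticalPhenomena.CardyFormulaZ2.Cruxes.NestingRigidity.PositiveConeWeightDoubling

end
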